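import Literature.Barriers.ValiantsHypothesis.MonotoneGap
import HarnessLib

/-!
# The monotone gap, companion fact: Jerrum–Snir's exact monotone `⊗`-complexity of the
Hamiltonian circuit polynomial (J. ACM 29 (1982), §4.4)

Sibling of `Literature/Barriers/ValiantsHypothesis/MonotoneGap.lean`, in the same model
(`IsMonotoneComputation`: plain fan-in-two circuits over the semiring `ℝ≥0`; `prodCount`: the
number of product gates = Jerrum–Snir's `⊗`-complexity) and in the same style as the named facts
`JerrumSnir1982_permanent` (§4.3, discharged in `MonotoneGapPermanentProofs.lean`) and
`JerrumSnir1982_spanningTree` (§4.5) stated there. This file only STATES the printed result of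
§4.4 as a named fact (D-0014); it is not proved here.

**The printed result** (read with `lit read doi:10.1145/322326.322341`, PDF pp. 16–18 =
pp. 889–891). §4.4 "HAMILTONIAN CIRCUIT POLYNOMIAL. Suppose again that `X` is an `n × n` matrix
of indeterminates `x_{ij}` (`1 ≤ i, j ≤ n`). The Hamiltonian circuit polynomial is
`HC_{n×n} = p = Σ_{π ∈ C(n)} x_{1,π(1)} x_{2,π(2)} ⋯ x_{n,π(n)}`, where `C(n)` is the set of all
cyclic permutations of the first `n` natural numbers." With the content bound
`c(r,d) = (d-1)!(r-d-1)!(n-r-1)!` (`r < n`), `(d-1)!(n-d-1)!` (`r = n`) — obtained from "viewing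
`π` as a circle, `π*` is the circle obtained by deleting vertices not in `I_a` ... `π*` is a cyclic
permutation; hence the number of extensions of `π` to `I_a` is bounded by the number of cyclic
permutations on `d` objects; that is, `|mon(a)| ≤ (d-1)!`" — and Corollary 3.5:
"`⊗`-complexity of `p ≥ (n-1)! [2^{(n-3)}(n-2) + 1]/(n-2)! = (n-1)[(n-2) 2^{(n-3)} + 1]`.
Again this bound is valid for `R`, `M`, and `M⁺`, and is attainable": the dynamic programme over
the path polynomials `p_{I,i,j}` (all Hamiltonian paths of `K_n` from `i` to `j` through the node
set `I`), `p_{{i},i,j} = x_{ij}`, `p_{I,i,j} = Σ_{l ∈ I∖{i}} p_{I∖{i},l,j} x_{il}`, and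
`HC_{n×n}` assembled from the path polynomials on the node set `{2,…,n}` with `n-1` further
multiplications by the closing edges `x_{j1}`, "so it can be computed in
`(n-1)(n-2)2^{(n-3)} + (n-1)` multiplications" (p. 891, formula partly illegible in the scan).

**Rendering.** The tree's `hcPoly (Fin n) ℝ≥0 = Σ_{π an n-cycle} Π_i X (π i, i)`
(`Literature.Computability.AlgebraicComplexity.hcPoly`, via `Matrix.hamiltonianCycleSum`) has the
same monomials as the printed `HC_{n×n}` under `x_{ij} ↦ X (i, j)` (the monomial of `π` in the
printed convention is the tree's monomial of `π⁻¹`, and inversion permutes the `n`-cycles). As for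
the permanent, the semiring is fixed to `R = ℝ≥0`; the tree's model has no constant inputs, which
only strengthens the lower bound and is all the printed upper-bound programme uses. Stated for
`n ≥ 3`, where the printed `2^{(n-3)}` is an integer.

**Use.** Grounds `Summit.ValiantsHypothesis.ValiantsHypothesis.Theses.ImmanantSlice.MonotoneRigidity`
(route `ValiantsHypothesis/ImmanantSlice`, item `MonotoneRigidity`): for the class function
`χ_n = 𝟙[n-cycles]` the immanant-slice polynomial `d_χ` is `hcPoly`, and this fact is the printed
instance (exponential monotone complexity, hence the hypothesis of `MonotoneRigidity` fails for it)
of the counting mechanism — cyclic permutations respecting a balanced rectangle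
`{π : π(I) = J}` are few — that the item asserts for every fixed-point-free long-cycle class.

## References

* [JerrumSnir1982] M. Jerrum, M. Snir, *Some exact complexity results for straight-line
  computations over semirings*, J. ACM 29 (1982) 874–897, §4.4 (pp. 889–891), Cor. 3.5.
-/

namespace Literature.Barriers.ValiantsHypothesis

open Literature.Computability.AlgebraicComplexity
open scoped NNReal

/-- **Jerrum–Snir 1982, §4.4: the monotone `⊗`-complexity of the Hamiltonian circuit polynomial
is exactly `(n-1)[(n-2)2^{n-3} + 1]`.** "`⊗`-complexity of
`p ≥ (n-1)![2^{(n-3)}(n-2) + 1]/(n-2)! = (n-1)[(n-2)2^{(n-3)} + 1]`. Again this bound is valid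
for `R`, `M`, and `M⁺`, and is attainable" (by the Hamiltonian-path dynamic programme, "computed
in `(n-1)(n-2)2^{(n-3)} + (n-1)` multiplications", p. 891). Rendered for `R = ℝ≥0` in the model
of `MonotoneGap.lean` (every monotone computation of `hcPoly (Fin n) ℝ≥0` has at least, and some
has exactly, `(n-1)((n-2)2^{n-3} + 1)` product gates), `n ≥ 3`. Grounds
`Summit.ValiantsHypothesis.ValiantsHypothesis.Theses.ImmanantSlice.MonotoneRigidity` (the
`n`-cycle class instance of its rectangle-counting mechanism). [cite: JerrumSnir1982, §4.4 (pp. 889–891) and Cor. 3.5] -/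
def JerrumSnir1982_hamiltonianCircuit : Prop :=
  ∀ n : ℕ, 3 ≤ n →
    (∀ P : ArithCircuit ℝ≥0 (Fin n × Fin n), IsMonotoneComputation P (hcPoly (Fin n) ℝ≥0) →
        (n - 1) * ((n - 2) * 2 ^ (n - 3) + 1) ≤ prodCount P) ∧
      ∃ P : ArithCircuit ℝ≥0 (Fin n × Fin n), IsMonotoneComputation P (hcPoly (Fin n) ℝ≥0) ∧
        prodCount P = (n - 1) * ((n - 2) * 2 ^ (n - 3) + 1)

end Literature.Barriers.ValiantsHypothesis
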